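import Summits.RiemannHypothesis.RiemannHypothesis.Theorems.EtaLeadingQuarterSecondMomentAFETerms
import HarnessLib

/-!
# Sharp-ended eta vector at the zeros, II: the frequency sums away from `y`
# (route EtaLeadingQuarter, item `EtaLeadingSecondMoment`, stmt-RiemannHypothesis-21791)

Continuation of `EtaLeadingQuarterSecondMomentAFETerms.lean`: the sums of the per-frequency
estimates over the frequencies at distance `≥ 1` from `y = t/(2πa)` (no hypothesis on the
fractional part of `y`), and the negative frequencies for `y < 1`:

* `norm_sum_near_generic_le` — `ν ≤ m` with `m + 1 ≤ y`;
* `norm_sum_far_pos_generic_le` — `ν ≥ [y] + 2`;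
* `norm_sum_far_neg_small_le` — all negative frequencies, crude form `2‖s‖a^{-σ-1}/π²`.

RH-free real analysis (Titchmarsh §4.13 bookkeeping). Nothing here bears on the truth of RH.
-/

noncomputable section

open Complex MeasureTheory Set Filter intervalIntegral Finset
open scoped Real Topology Interval

set_option linter.dupNamespace false  -- the mandated namespace repeats `RiemannHypothesis`

namespace Summit.RiemannHypothesis.RiemannHypothesis.Theorems.EtaLeadingQuarter.SecondMomentAFE

open Literature.NumberTheory.LFunctions Literature.NumberTheory.LFunctions.AFE

/-! ## Sums away from the two adjacent frequencies -/

/-- `∑_{ν=1}^{m} 1/(y − ν) ≤ 1 + log(m+1)` when `y ≥ m + 1` (reflect `k = m − ν` and compare with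
the harmonic sum). [folklore] -/
theorem sum_inv_sub_le_log {y : ℝ} {m : ℕ} (hy : (m : ℝ) + 1 ≤ y) :
    ∑ ν ∈ Finset.Icc 1 m, (1 : ℝ) / (y - ν) ≤ 1 + Real.log (m + 1) := by
  have e : ∑ ν ∈ Finset.Icc 1 m, (1 : ℝ) / (y - ν)
      = ∑ k ∈ Finset.range m, (1 : ℝ) / (y - m + k) := by
    symm
    apply Finset.sum_nbij' (fun k => m - k) (fun ν => m - ν)
    · intro k hk; simp [Finset.mem_Icc] at hk ⊢; omega
    · intro ν hν; simp [Finset.mem_Icc] at hν ⊢; omega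
    · intro k hk; simp at hk; omega
    · intro ν hν; simp [Finset.mem_Icc] at hν; omega
    · intro k hk
      simp only [Finset.mem_range] at hk
      rw [Nat.cast_sub hk.le]
      ring_nf
  rw [e]
  calc ∑ k ∈ Finset.range m, (1 : ℝ) / (y - m + k)
      ≤ ∑ k ∈ Finset.range m, (1 : ℝ) / (1 + k) := by
        apply Finset.sum_le_sum; intro k _
        exact one_div_le_one_div_of_le (by positivity) (by linarith)
    _ ≤ 1 + Real.log (m + 1) := sum_range_inv_succ_le_log m

/-- **Near frequencies at distance `≥ 1` below `y`, summed**: for `m + 1 ≤ y`, `0 < a ≤ N`,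
`t = 2πay ≤ πN`, `0 < σ < 1`,
`‖∑_{ν=1}^{m} ∫_a^N u^{-s} e(νu) du − afeCoeff(s) ∑_{ν=1}^{m} ν^{s-1}‖`
`≤ (4N^{-σ}/π)(1 + log(m+1)) + m a^{1-σ}/t + (2a^{-σ}/π)(1 + log(m+1))`
(the tree's `AFE.norm_sum_near_sub_le` without the frequency nearest to `y`, hence without any
hypothesis on `{y}`). [folklore] -/
theorem norm_sum_near_generic_le {s : ℂ} (hσ0 : 0 < s.re) (hσ1 : s.re < 1) {a y : ℝ}
    (ha : 0 < a) (ht : s.im = 2 * π * a * y) {m : ℕ} (hmy : (m : ℝ) + 1 ≤ y) {N : ℕ}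
    (haN : a ≤ N) (hNt : s.im ≤ π * N) :
    ‖(∑ ν ∈ Finset.Icc 1 m,
        ∫ u in a..N, (u : ℂ) ^ (-s) * Complex.exp (((2 * π * ν * u : ℝ) : ℂ) * I))
        - afeCoeff s * ∑ ν ∈ Finset.Icc 1 m, (ν : ℂ) ^ (s - 1)‖
      ≤ 4 * (N : ℝ) ^ (-s.re) / π * (1 + Real.log (m + 1)) + m * (a ^ (1 - s.re) / s.im)
        + 2 / π * a ^ (-s.re) * (1 + Real.log (m + 1)) := by
  have hπ := Real.pi_pos
  have htpos : 0 < s.im := by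
    rw [ht]
    have : (0 : ℝ) < y := by have := (Nat.cast_nonneg m : (0 : ℝ) ≤ m); linarith
    positivity
  have hNpos : (0 : ℝ) < N := ha.trans_le haN
  have hdist : (∑ ν ∈ Finset.Icc 1 m,
        ∫ u in a..N, (u : ℂ) ^ (-s) * Complex.exp (((2 * π * ν * u : ℝ) : ℂ) * I))
        - afeCoeff s * ∑ ν ∈ Finset.Icc 1 m, (ν : ℂ) ^ (s - 1)
      = ∑ ν ∈ Finset.Icc 1 m,
        ((∫ u in a..N, (u : ℂ) ^ (-s) * Complex.exp (((2 * π * ν * u : ℝ) : ℂ) * I))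
          - afeCoeff s * (ν : ℂ) ^ (s - 1)) := by
    rw [Finset.mul_sum, Finset.sum_sub_distrib]
  rw [hdist]
  have hterm : ∀ ν ∈ Finset.Icc 1 m,
      ‖(∫ u in a..N, (u : ℂ) ^ (-s) * Complex.exp (((2 * π * ν * u : ℝ) : ℂ) * I))
          - afeCoeff s * (ν : ℂ) ^ (s - 1)‖
        ≤ 4 * (N : ℝ) ^ (-s.re) / π * (1 / ν) + a ^ (1 - s.re) / s.im
          + 2 / π * a ^ (-s.re) * (1 / (y - ν)) := by
    intro ν hν
    have hν1 := (Finset.mem_Icc.1 hν).1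
    have hνm : (ν : ℝ) ≤ m := by exact_mod_cast (Finset.mem_Icc.1 hν).2
    have h := near_term_le hσ0 hσ1 ha ht hν1 (by linarith) haN hNt
    rw [show 2 / π * a ^ (-s.re) / (y - ν) = 2 / π * a ^ (-s.re) * (1 / (y - ν)) by ring] at h
    exact h
  refine (norm_sum_le _ _).trans ((Finset.sum_le_sum hterm).trans ?_)
  rw [Finset.sum_add_distrib, Finset.sum_add_distrib, ← Finset.mul_sum, ← Finset.mul_sum,
    Finset.sum_const, Nat.card_Icc, Nat.add_sub_cancel, nsmul_eq_mul]
  have hA := mul_le_mul_of_nonneg_left (sum_Icc_inv_le_log m)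
    (by positivity : (0 : ℝ) ≤ 4 * (N : ℝ) ^ (-s.re) / π)
  have hC := mul_le_mul_of_nonneg_left (sum_inv_sub_le_log hmy)
    (by positivity : (0 : ℝ) ≤ 2 / π * a ^ (-s.re))
  linarith

/-- **Far frequencies at distance `≥ 1` above `y`, summed**: with `t = 2πay`, `y ≥ 0`, `n = [y]`,
`∑_{ν=n+2}^{V} ‖s (2πiν)^{-1} ∫_a^N u^{-s-1} e(νu) du‖ ≤ (‖s‖ a^{-σ-1}/π²) (1 + log(n+2))/(n+1)`
(the tree's `AFE.norm_sum_far_pos_le` without the frequency nearest to `y`, hence without any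
hypothesis on `{y}`). [folklore] -/
theorem norm_sum_far_pos_generic_le {s : ℂ} (hσ : 0 < s.re) {a y : ℝ} (ha : 0 < a)
    (ht : s.im = 2 * π * a * y) {N V : ℕ} (haN : a ≤ N) :
    ∑ ν ∈ Finset.Icc (⌊y⌋₊ + 2) V,
        ‖s * ((1 / (2 * π * I * ν))
          * ∫ u in a..N, (u : ℂ) ^ (-s - 1) * Complex.exp (((2 * π * ν * u : ℝ) : ℂ) * I))‖
      ≤ ‖s‖ * a ^ (-s.re - 1) / π ^ 2 * ((1 + Real.log (⌊y⌋₊ + 2)) / (⌊y⌋₊ + 1)) := by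
  have hπ := Real.pi_pos
  set n : ℕ := ⌊y⌋₊ with hn
  have hyn : y < n + 1 := Nat.lt_floor_add_one y
  have hterm : ∀ ν ∈ Finset.Icc (n + 2) V,
      ‖s * ((1 / (2 * π * I * ν))
          * ∫ u in a..N, (u : ℂ) ^ (-s - 1) * Complex.exp (((2 * π * ν * u : ℝ) : ℂ) * I))‖
        ≤ ‖s‖ * a ^ (-s.re - 1) / π ^ 2 * (1 / (ν * (ν - y))) := by
    intro ν hν
    have hν2 : n + 2 ≤ ν := (Finset.mem_Icc.1 hν).1
    have hνR : (n : ℝ) + 2 ≤ ν := by exact_mod_cast hν2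
    have hν1 : 1 ≤ ν := by omega
    have hνpos : (0 : ℝ) < ν := by linarith
    have hνy : 0 < (ν : ℝ) - y := by linarith
    have hpos : 0 < a * (ν - y) + ν * 0 := by rw [mul_zero, add_zero]; positivity
    have h := far_pos_term_split_le hσ ha ht hν1 le_rfl hpos (N := N) (by rw [add_zero]; exact haN)
    rw [mul_zero, add_zero, zero_mul, zero_add] at h
    refine h.trans (le_of_eq ?_)
    rw [show -s.re - 1 = -s.re + (-1 : ℝ) by ring, Real.rpow_add ha, Real.rpow_neg_one]
    field_simp
  refine (Finset.sum_le_sum hterm).trans ?_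
  rw [← Finset.mul_sum]
  refine mul_le_mul_of_nonneg_left ?_ (by positivity)
  -- `∑_{ν=n+2}^{V} 1/(ν(ν-y)) ≤ ∑_{k=1}^{V-(n+1)} 1/(k(n+1+k)) ≤ (1+log(n+2))/(n+1)`
  have e : ∑ ν ∈ Finset.Icc (n + 2) V, (1 : ℝ) / (ν * (ν - y))
      ≤ ∑ k ∈ Finset.Icc 1 (V - (n + 1)), (1 : ℝ) / (k * ((n + 1 : ℕ) + k)) := by
    rw [show ∑ k ∈ Finset.Icc 1 (V - (n + 1)), (1 : ℝ) / (k * ((n + 1 : ℕ) + k))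
        = ∑ ν ∈ Finset.Icc (n + 2) V, (1 : ℝ) / ((ν - (n + 1) : ℕ) * ((n + 1 : ℕ) + (ν - (n + 1) : ℕ)))
        from ?_]
    · apply Finset.sum_le_sum
      intro ν hν
      have hν2 : n + 2 ≤ ν := (Finset.mem_Icc.1 hν).1
      have hνR : (n : ℝ) + 2 ≤ ν := by exact_mod_cast hν2
      have hνpos : (0 : ℝ) < ν := by linarith
      have hνy : 0 < (ν : ℝ) - y := by linarith
      have hk : (((ν - (n + 1) : ℕ) : ℝ)) = ν - (n + 1) := by
        rw [Nat.cast_sub (by omega)]; push_cast; ring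
      rw [hk]
      push_cast
      rw [show (ν : ℝ) - (n + 1) = ν - n - 1 by ring,
        show ((n : ℝ) + 1 + (ν - n - 1)) = ν by ring]
      apply one_div_le_one_div_of_le (by nlinarith)
      have : (ν : ℝ) - n - 1 ≤ ν - y := by linarith
      exact mul_le_mul_of_nonneg_left this hνpos.le |>.trans_eq' (by ring) |>.trans (le_of_eq (by ring))
    · apply Finset.sum_nbij' (fun k => k + (n + 1)) (fun ν => ν - (n + 1))
      · intro k hk; simp [Finset.mem_Icc] at hk ⊢; omega
      · intro ν hν; simp [Finset.mem_Icc] at hν ⊢; omega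
      · intro k hk; simp at hk; omega
      · intro ν hν; simp [Finset.mem_Icc] at hν; omega
      · intro k hk
        simp only [Nat.add_sub_cancel]
  refine e.trans ?_
  have h := sum_inv_mul_shift_le (n₀ := n + 1) (by omega) (V - (n + 1))
  push_cast at h ⊢
  rw [show (n : ℝ) + 1 + 1 = n + 2 by ring] at h
  exact h

/-- **Negative frequencies, crude form** (all `t ≥ 0`):
`∑_{ν=1}^{V} ‖s (2πiν)^{-1} ∫_a^N u^{-s-1} e(−νu) du‖ ≤ 2‖s‖ a^{-σ-1}/π²`
(per term `≤ ‖s‖ a^{-σ-1}/(π²ν²)` by the tree's `AFE.norm_integral_far_neg_le`; used for `y < 1`,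
where the tree's `AFE.norm_sum_far_neg_le` does not apply). [folklore] -/
theorem norm_sum_far_neg_small_le {s : ℂ} (hσ : 0 < s.re) (ht0 : 0 ≤ s.im) {a : ℝ} (ha : 0 < a)
    {N V : ℕ} (haN : a ≤ N) :
    ∑ ν ∈ Finset.Icc 1 V,
        ‖s * ((1 / (2 * π * I * ν))
          * ∫ u in a..N, (u : ℂ) ^ (-s - 1) * Complex.exp (((-(2 * π * ν) * u : ℝ) : ℂ) * I))‖
      ≤ 2 * ‖s‖ * a ^ (-s.re - 1) / π ^ 2 := by
  have hπ := Real.pi_pos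
  have hterm : ∀ ν ∈ Finset.Icc 1 V,
      ‖s * ((1 / (2 * π * I * ν))
          * ∫ u in a..N, (u : ℂ) ^ (-s - 1) * Complex.exp (((-(2 * π * ν) * u : ℝ) : ℂ) * I))‖
        ≤ ‖s‖ * a ^ (-s.re - 1) / π ^ 2 * (1 / (ν : ℝ) ^ 2) := by
    intro ν hν
    have hν1 : (1 : ℝ) ≤ ν := by exact_mod_cast (Finset.mem_Icc.1 hν).1
    have hνpos : (0 : ℝ) < ν := by linarith
    have hI := norm_integral_far_neg_le hσ ht0 ha haN hνpos
    rw [norm_mul, norm_mul, norm_one_div_two_pi_I_mul_nat hνpos]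
    have hden : 2 * π * ν * a ≤ 2 * π * ν * a + s.im := by linarith
    have hpos : 0 < 2 * π * ν * a := by positivity
    calc ‖s‖ * (1 / (2 * π * ν) * ‖∫ u in a..N, (u : ℂ) ^ (-s - 1)
          * Complex.exp (((-(2 * π * ν) * u : ℝ) : ℂ) * I)‖)
        ≤ ‖s‖ * (1 / (2 * π * ν) * (4 * (a ^ (-s.re) / (2 * π * ν * a + s.im)))) := by gcongr
      _ ≤ ‖s‖ * (1 / (2 * π * ν) * (4 * (a ^ (-s.re) / (2 * π * ν * a)))) := by gcongr
      _ = ‖s‖ * a ^ (-s.re - 1) / π ^ 2 * (1 / (ν : ℝ) ^ 2) := by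
          rw [Real.rpow_sub ha, Real.rpow_one]; field_simp; ring
  refine (Finset.sum_le_sum hterm).trans ?_
  rw [← Finset.mul_sum]
  have hsq : ∑ ν ∈ Finset.Icc 1 V, (1 : ℝ) / (ν : ℝ) ^ 2 ≤ 2 := by
    rcases Nat.eq_zero_or_pos V with hV | hV
    · subst hV; simp
    · rw [show Finset.Icc 1 V = insert 1 (Finset.Ioc 1 V) by
          ext ν; simp [Finset.mem_Icc, Finset.mem_Ioc]; omega,
        Finset.sum_insert (by simp)]
      have h := sum_Ioc_inv_sq_le (le_refl 1) V
      push_cast at h ⊢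
      norm_num at h ⊢
      linarith
  calc ‖s‖ * a ^ (-s.re - 1) / π ^ 2 * ∑ ν ∈ Finset.Icc 1 V, (1 : ℝ) / (ν : ℝ) ^ 2
      ≤ ‖s‖ * a ^ (-s.re - 1) / π ^ 2 * 2 :=
        mul_le_mul_of_nonneg_left hsq (by positivity)
    _ = 2 * ‖s‖ * a ^ (-s.re - 1) / π ^ 2 := by ring

end Summit.RiemannHypothesis.RiemannHypothesis.Theorems.EtaLeadingQuarter.SecondMomentAFE

end
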